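import Summits.ABC.ABC.Theses.DefiniteXi
import Literature.NumberTheory.EllipticCurves.OpenImageMazurAssemblyProofs
import Literature.NumberTheory.EllipticCurves.OpenImageMazurInertiaThreeProofs
import Literature.NumberTheory.EllipticCurves.OpenImageMazurTwistProofs
import Literature.NumberTheory.EllipticCurves.CyclicIsogenyCharacterFrobeniusProofs
import Literature.NumberTheory.EllipticCurves.RationalIsogenyFrobeniusCriterionPrimePower
import Literature.NumberTheory.EllipticCurves.RationalIsogenyDegreesProofs
import Literature.NumberTheory.EllipticCurves.OrdinaryReductionTorsionCharactersProofs
import Literature.NumberTheory.EllipticCurves.OrdinaryReductionUnramifiedCharacterProofs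
import Literature.NumberTheory.EllipticCurves.TateCurve.NumberFieldUniformizationTwisted
import Literature.NumberTheory.EllipticCurves.TateCurve.NumberFieldUniformizationTwistedKernelOfReduction
import Literature.NumberTheory.EllipticCurves.TateCurve.MultiplicativeTwistUnramifiedProofs
import Literature.NumberTheory.EllipticCurves.QuadraticTwistTateFormProofs
import Literature.NumberTheory.GaloisRepresentations.DecompositionGroupOfCompletion
import Literature.NumberTheory.GaloisRepresentations.TateLevelOneWildOdd
import Literature.NumberTheory.Automorphic.AdicCompletionLocalField
import HarnessLib

/-!
# Stub-ideation k=2 (gen 7, FAMILY 2 — RESHAPE) for `stub_pasten163` — crux `DefiniteRTControlPrime`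

Companion to `STUB-IDEAS-stub_pasten163-2.md` (gen 7).  Scratch check that the helper STATEMENTS
elaborate; every `sorry` is a HELPER BODY for a stub prover (one cycle each); the `sorry`-free items are
the algebraic/arithmetic ends of the chain (D1 = the Borel SANDWICH is PROVED here; U1, T1, A1, OPEN, C1
are carried over proved from gens 3–5).

Plan A (verbatim stub) = `PastenShimura2024_minimalDegree_le_163_mul_of_mazurKenku' hMK`
(`163` is attained by CM `−163`, `PastenShimura2024_minimalDegree_le_163_mul_iff`): blocked on the
shared item `IsogenyGlueCongruence.MazurKenkuBound` (stmt-ABC-15125).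

Plan B (RESHAPE, uses the idle `C·N^ε` of the crux).  Gen 7 returns to gen 3's SINGLE LINE / SINGLE
CHARACTER cut (`ℤP ⊂ W[ℓᵏ]`, `r : Γ_ℚ → (ℤ/ℓᵏ)ˣ`) — no middle curve (gen 5 M1/DIAG/DICH/COVER), no
second character / Weil pairing (gen 4–5 DET), no `(a,b)`-sandwich (gen 4 ALG), no Minkowski normal
form `b·χ^ε` (gen 3 G1/D5) — and closes the reason gen 4 left it ("D3, the twisted Tate transport at
`v = ℓ`, is the hardest helper"): the tree has SINCE-AUDITED landed inputs that make BOTH containers at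
`v = ℓ` pure transport —
* ordinary: `ordinaryReduction_inertia_smul_of_mem_kernelReduction_holds`,
  `ordinaryReduction_exists_unramified_character_mod_kernelReduction_holds` (Greenberg LNM 1716 §2,
  PROVED), `inertia_adicCompletionPrime_eq_map_absInertia` (`I_{𝔓₀} = res I_{ℚ_ℓ}`),
  `modNCyclotomicCharacter_absGaloisRestrict`, `modNCyclotomicCharacter_eq_toZModPow_cyclotomicCharacter`;
* multiplicative: `TateCurve.exists_twistedTateUniformisation_localKernelOfReduction` (`Ψ : ℚ̄_ℓˣ ↠
  E(ℚ̄_ℓ)`, kernel `q^ℤ`, twisted equivariance) AND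
  `TateCurve.toAlgEquiv_eq_of_mem_inertia_of_sq_eq_gamma` (inertia fixes `√γ`, so `Ψ` is
  `I`-EQUIVARIANT: the sign `s` of gen 3's D3 is `1` — both containers have the SAME shape `x = χ`, `y = 1`).
With the container in hand, D1 (PROVED below) gives the EXACT dichotomy `r|_{I_ℓ} ∈ {1, χ_{ℓᵏ}}`;
unipotence at multiplicative `v ∤ ℓ` costs half the level (U1/U2, sharp: `11a3 → 11a1 → 11a2`);
Minkowski (`Mazur1978.monoidHom_eq_one_of_forall_inertia`) on `ψ = r̄¹²` resp. `(r̄χ̄⁻¹)¹²`;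
Frobenius congruence + A1 ⇒ `ℓ^⌈k/2⌉ ∣ n₁₂(p)`; counting ⇒ C0² ⇒ (gen 6 B1/B2, exponent 2) ⇒
`FreyClassRadiusSubpoly` ⇒ G4 `definiteRTControlPrime_of_freyClassRadiusSubpoly` (crux workfile
`StubIdeasK2G4PastenLemma68.lean`, 0 sorries) `+ stub_takahashi` ⇒ crux.
-/

namespace Summit.ABC.ABC.Cruxes.DefiniteRTControlPrime.Sketch.Ideas2g7

open Literature.NumberTheory.EllipticCurves Literature.NumberTheory.GaloisRepresentations
open WeierstrassCurve IsDedekindDomain NumberField Field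

/-! ## §0 Landed inputs at `v = ℓ`, checked by name (all PROVED in the tree) -/

example : ordinaryReduction_inertia_smul_of_mem_kernelReduction :=
  ordinaryReduction_inertia_smul_of_mem_kernelReduction_holds

example : ordinaryReduction_exists_unramified_character_mod_kernelReduction :=
  ordinaryReduction_exists_unramified_character_mod_kernelReduction_holds

/-- The global↔local inertia transport at the chosen prime `𝔓₀` over `v` (instances for `ℚ_v` from
`Automorphic.AdicCompletionLocalField`). -/
example (v : HeightOneSpectrum (𝓞 ℚ)) :
    (adicCompletionPrime ℚ v).inertia (absoluteGaloisGroup ℚ) =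
      (absInertia (v.adicCompletion ℚ)).map (absGaloisRestrict ℚ (v.adicCompletion ℚ)).toMonoidHom :=
  inertia_adicCompletionPrime_eq_map_absInertia ℚ v

/-! ## §1 Arithmetic of the half level (gen 3, verbatim, proved) -/

/-- `⌈k/2⌉`. -/
def halfCeil (k : ℕ) : ℕ := (k + 1) / 2

theorem halfCeil_le (k : ℕ) : halfCeil k ≤ k := by unfold halfCeil; omega

theorem le_two_mul_halfCeil (k : ℕ) : k ≤ 2 * halfCeil k := by unfold halfCeil; omega

theorem pow_halfCeil_dvd (ℓ k : ℕ) : ℓ ^ halfCeil k ∣ ℓ ^ k := pow_dvd_pow ℓ (halfCeil_le k)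

/-- U1 (PROVED, gen 3): `(s−1)²·P = 0` for `P` of order `ℓᵏ` forces `ℓ^⌈k/2⌉ ∣ s − 1`. -/
theorem pow_halfCeil_dvd_of_sq_smul_eq_zero {M : Type*} [AddCommGroup M] {ℓ k : ℕ} (hℓ : ℓ.Prime)
    {P : M} (hP : addOrderOf P = ℓ ^ k) {s : ℤ} (hs : ((s - 1) ^ 2) • P = 0) :
    (ℓ : ℤ) ^ halfCeil k ∣ s - 1 := by
  haveI := Fact.mk hℓ
  have h1 : ((ℓ : ℤ) ^ k) ∣ (s - 1) ^ 2 := by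
    have := addOrderOf_dvd_iff_zsmul_eq_zero.mpr hs
    rw [hP] at this
    exact_mod_cast this
  rcases eq_or_ne (s - 1) 0 with h0 | h0
  · rw [h0]; exact dvd_zero _
  rw [padicValInt_dvd_iff] at h1 ⊢
  refine Or.inr ?_
  rcases h1 with h1 | h1
  · exact absurd (pow_eq_zero_iff two_ne_zero |>.mp h1) h0
  · rw [pow_two, padicValInt.mul h0 h0] at h1
    unfold halfCeil
    omega

/-! ## §2 D1 — the Borel SANDWICH on ONE line (PROVED; gen 3 left it `sorry`) -/

/-- **D1 (pure algebra, PROVED).**  A subgroup `E₁ ≤ M` ("kernel of reduction" / "torus") such that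
each endomorphism `τ i` acts by the scalar `x i` on `E₁[ℓᵏ]` and by `y i` modulo `E₁` on `M[ℓᵏ]`; if ONE
`x i₀ − y i₀` is prime to `ℓ`, then a cyclic line `ℤP` of order `ℓᵏ` on which every `τ i` acts by a
scalar `lam i` has EITHER all `lam i ≡ y i` OR all `lam i ≡ x i (mod ℓᵏ)`.  (`{n : nP ∈ E₁} = ℓ^μℤ`
by Bézout; `ℓ^μ ∣ lam − y`, `ℓ^{k−μ} ∣ lam − x`; `0 < μ < k` would give `ℓ ∣ x i₀ − y i₀`.) -/
theorem filtration_dichotomy {M : Type*} [AddCommGroup M] {ℓ k : ℕ} (hℓ : ℓ.Prime)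
    (E₁ : AddSubgroup M) {ι : Type*} (τ : ι → M →+ M) (x y : ι → ℤ)
    (hx : ∀ i, ∀ Q ∈ E₁, ℓ ^ k • Q = 0 → τ i Q = x i • Q)
    (hy : ∀ i (Q : M), ℓ ^ k • Q = 0 → τ i Q - y i • Q ∈ E₁)
    (i₀ : ι) (hi₀ : ¬ ((ℓ : ℤ) ∣ x i₀ - y i₀))
    {P : M} (hP : addOrderOf P = ℓ ^ k) (lam : ι → ℤ) (hlam : ∀ i, τ i P = lam i • P) :
    (∀ i, (ℓ : ℤ) ^ k ∣ lam i - y i) ∨ (∀ i, (ℓ : ℤ) ^ k ∣ lam i - x i) := by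
  classical
  have hℓ0 : (ℓ : ℤ) ≠ 0 := by exact_mod_cast hℓ.ne_zero
  have hPk : ℓ ^ k • P = 0 := by rw [← hP]; exact addOrderOf_nsmul_eq_zero P
  have hPk' : ((ℓ ^ k : ℕ) : ℤ) • P = 0 := by rw [natCast_zsmul]; exact hPk
  have hord : ∀ n : ℤ, n • P = 0 ↔ (ℓ : ℤ) ^ k ∣ n := fun n => by
    rw [← addOrderOf_dvd_iff_zsmul_eq_zero, hP, Int.natCast_pow]
  -- the least `c` with `ℓ ^ c • P ∈ E₁`
  have hex : ∃ c : ℕ, ℓ ^ c • P ∈ E₁ := ⟨k, by rw [hPk]; exact E₁.zero_mem⟩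
  obtain ⟨μ, hμmem, hμmin⟩ : ∃ μ : ℕ, ℓ ^ μ • P ∈ E₁ ∧ ∀ c : ℕ, ℓ ^ c • P ∈ E₁ → μ ≤ c :=
    ⟨Nat.find hex, Nat.find_spec hex, fun c hc => Nat.find_min' hex hc⟩
  have hμk : μ ≤ k := hμmin k (by rw [hPk]; exact E₁.zero_mem)
  -- `{n : n • P ∈ E₁} ⊆ ℓ^μ ℤ` (Bézout with `ℓ^k`)
  have hgen : ∀ n : ℤ, n • P ∈ E₁ → (ℓ : ℤ) ^ μ ∣ n := by
    intro n hn
    have hbez : ((Int.gcd n ((ℓ ^ k : ℕ) : ℤ) : ℕ) : ℤ) • P ∈ E₁ := by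
      rw [Int.gcd_eq_gcd_ab n ((ℓ ^ k : ℕ) : ℤ), add_smul, mul_comm n, mul_smul,
        mul_comm ((ℓ ^ k : ℕ) : ℤ), mul_smul, hPk', smul_zero, add_zero]
      exact E₁.zsmul_mem hn _
    have hdvd : Int.gcd n ((ℓ ^ k : ℕ) : ℤ) ∣ ℓ ^ k :=
      Int.natCast_dvd_natCast.mp (Int.gcd_dvd_right _ _)
    obtain ⟨c, -, hc⟩ := (Nat.dvd_prime_pow hℓ).mp hdvd
    have hμc : μ ≤ c := hμmin c (by rw [← hc, ← natCast_zsmul]; exact hbez)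
    have hn' : ((Int.gcd n ((ℓ ^ k : ℕ) : ℤ) : ℕ) : ℤ) ∣ n := Int.gcd_dvd_left _ _
    rw [hc, Int.natCast_pow] at hn'
    exact (pow_dvd_pow _ hμc).trans hn'
  -- (a) `ℓ^μ ∣ lam − y`
  have hy' : ∀ i, (ℓ : ℤ) ^ μ ∣ lam i - y i := fun i => hgen _ (by
    rw [sub_smul, ← hlam]; exact hy i P hPk)
  -- (b) `ℓ^(k−μ) ∣ lam − x`
  have hx' : ∀ i, (ℓ : ℤ) ^ (k - μ) ∣ lam i - x i := by
    intro i
    have h0 : ℓ ^ k • (ℓ ^ μ • P) = 0 := by rw [smul_comm, hPk, smul_zero]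
    have h1 : τ i (ℓ ^ μ • P) = x i • (ℓ ^ μ • P) := hx i _ hμmem h0
    rw [map_nsmul, hlam] at h1
    have h2 : (((ℓ ^ μ : ℕ) : ℤ) * (lam i - x i)) • P = 0 := by
      rw [mul_sub, sub_smul, mul_comm _ (x i), mul_smul, mul_smul, natCast_zsmul, natCast_zsmul,
        h1, sub_self]
    have h3 : (ℓ : ℤ) ^ k ∣ ((ℓ ^ μ : ℕ) : ℤ) * (lam i - x i) := (hord _).mp h2
    rw [Int.natCast_pow, ← Nat.sub_add_cancel hμk, pow_add, mul_comm ((ℓ : ℤ) ^ (k - μ))] at h3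
    exact (mul_dvd_mul_iff_left (pow_ne_zero μ hℓ0)).mp h3
  -- dichotomy
  rcases Nat.eq_zero_or_pos μ with hμ0 | hμpos
  · refine Or.inr fun i => ?_
    have := hx' i
    rwa [hμ0, Nat.sub_zero] at this
  · rcases hμk.eq_or_lt with hμk' | hμlt
    · exact Or.inl fun i => by rw [← hμk']; exact hy' i
    · exfalso
      refine hi₀ ?_
      have h1 : (ℓ : ℤ) ∣ lam i₀ - y i₀ := (dvd_pow_self (ℓ : ℤ) hμpos.ne').trans (hy' i₀)
      have h2 : (ℓ : ℤ) ∣ lam i₀ - x i₀ :=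
        (dvd_pow_self (ℓ : ℤ) (Nat.sub_pos_of_lt hμlt).ne').trans (hx' i₀)
      have h3 := dvd_sub h1 h2
      rwa [sub_sub_sub_cancel_left] at h3

/-! ## §3 The two containers at `v = ℓ` (transport of PROVED local facts; one cycle each) -/

/-- **D2 = FILT-ord (S–M, inputs PROVED).**  At a good ORDINARY place `v ∣ ℓ` there is a subgroup
`E₁ ≤ W(ℚ̄)` with: inertia acts on `E₁[ℓᵏ]` through `χ_{ℓᵏ}` and trivially modulo `E₁` on `W[ℓᵏ]`.
Route: at `𝔓₀ := adicCompletionPrime ℚ v` take `E₁ :=` the preimage of `W.localKernelOfReduction v` under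
`pointsMapOfEmb W (closureEmb (v.adicCompletion ℚ))`; `τ ∈ I_{𝔓₀}` is `res σ`, `σ ∈ absInertia ℚ_v`
(`inertia_adicCompletionPrime_eq_map_absInertia`); clause 1 is
`ordinaryReduction_inertia_smul_of_mem_kernelReduction_holds` read through
`modNCyclotomicCharacter_absGaloisRestrict` + `modNCyclotomicCharacter_eq_toZModPow_cyclotomicCharacter`;
clause 2 is `ordinaryReduction_exists_unramified_character_mod_kernelReduction_holds` with `φ = 1` on
inertia.  A general `𝔓 = g • 𝔓₀` (`exists_smul_eq_of_mem_primesAbove_holds`) gets `g • E₁`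
(`inertia_smul_eq_map_conj'`, `χ(gτg⁻¹) = χ(τ)`). -/
theorem exists_ordinaryFiltration (W : WeierstrassCurve ℚ) [W.IsElliptic]
    {v : HeightOneSpectrum (𝓞 ℚ)} (hgood : W.HasGoodReductionAt v) {ℓ : ℕ} [Fact ℓ.Prime]
    (hℓv : (ℓ : 𝓞 ℚ) ∈ v.asIdeal) (hord : ¬ ((ℓ : ℤ) ∣ W.frobeniusTraceAt v)) (k : ℕ)
    {𝔓 : Ideal (absIntegers (𝓞 ℚ) ℚ)} (h𝔓 : 𝔓 ∈ v.primesAbove) :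
    ∃ E₁ : AddSubgroup (geomPoints W),
      (∀ τ ∈ 𝔓.inertia (absoluteGaloisGroup ℚ), ∀ Q ∈ E₁, ℓ ^ k • Q = 0 →
        τ • Q = ((((modNCyclotomicCharacter ℚ (ℓ ^ k) τ : (ZMod (ℓ ^ k))ˣ) :
          ZMod (ℓ ^ k)).val : ℤ)) • Q) ∧
      (∀ τ ∈ 𝔓.inertia (absoluteGaloisGroup ℚ), ∀ Q : geomPoints W, ℓ ^ k • Q = 0 →
        τ • Q - Q ∈ E₁) := by
  sorry

/-- **D3′ = FILT-mult (M, inputs PROVED; gen 3's D3 WITHOUT the sign).**  At a MULTIPLICATIVE place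
`v ∣ ℓ` there is a subgroup `E₁ ≤ W(ℚ̄)` (the transported toric torsion `Ψ(μ_{ℓ^∞})`) with the SAME two
clauses.  Route: `TateCurve.exists_twistedTateUniformisation_localKernelOfReduction` (`Ψ`, kernel `q^ℤ`,
`σ•Ψ(u) = ±Ψ(σu)` with `+` iff `σ√γ = √γ`) and `TateCurve.toAlgEquiv_eq_of_mem_inertia_of_sq_eq_gamma`
(inertia FIXES `√γ` ⇒ `Ψ` is `I_𝔐`-equivariant); for `ℓᵏΨ(u) = 0`, `u^{ℓᵏ} ∈ q^ℤ ⊂ ℚ_vˣ` so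
`σu/u ∈ μ_{ℓᵏ}` and `σζ = ζ^{χ(σ)}`; transport `I_𝔓 ↝ I_𝔐` and `E(ℚ̄) ↪ E(ℚ̄_v)` exactly as in the landed
`smul_smul_sub_eq_of_mem_inertia_geomPoints` / `exists_tateBasis_geomTorsion_of_hasMultiplicativeReductionAt`
(`primeBelow`, `exists_mem_inertia_apply_eq_holds`, `exists_pointsMapOfEmb_eq_of_nsmul_eq_zero`,
`pointsMapOfEmb_injective`). -/
theorem exists_multiplicativeFiltration (W : WeierstrassCurve ℚ) [W.IsElliptic]
    {v : HeightOneSpectrum (𝓞 ℚ)} (hv : W.HasMultiplicativeReductionAt v) {ℓ : ℕ} [Fact ℓ.Prime]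
    (hℓv : (ℓ : 𝓞 ℚ) ∈ v.asIdeal) (k : ℕ)
    {𝔓 : Ideal (absIntegers (𝓞 ℚ) ℚ)} (h𝔓 : 𝔓 ∈ v.primesAbove) :
    ∃ E₁ : AddSubgroup (geomPoints W),
      (∀ τ ∈ 𝔓.inertia (absoluteGaloisGroup ℚ), ∀ Q ∈ E₁, ℓ ^ k • Q = 0 →
        τ • Q = ((((modNCyclotomicCharacter ℚ (ℓ ^ k) τ : (ZMod (ℓ ^ k))ˣ) :
          ZMod (ℓ ^ k)).val : ℤ)) • Q) ∧
      (∀ τ ∈ 𝔓.inertia (absoluteGaloisGroup ℚ), ∀ Q : geomPoints W, ℓ ^ k • Q = 0 →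
        τ • Q - Q ∈ E₁) := by
  sorry

/-- SS (S, gen 4 verbatim): a `Γ_ℚ`-stable point of prime order `ℓ ≥ 3` excludes good SUPERSINGULAR
reduction at `ℓ` (the `exfalso` branch of `Mazur1978.modEq_zero_or_one_of_hasGoodReductionAtPrime`).
Applied to `ℓ^{k−1}·P`. -/
theorem not_dvd_frobeniusTrace_of_stableLine (W : WeierstrassCurve ℚ) [W.IsElliptic]
    [W.IsGloballyMinimal] (ℓ : ℕ) [Fact ℓ.Prime] (hℓ3 : 3 ≤ ℓ)
    (hgood : W.HasGoodReductionAtPrime ℓ) {P : geomPoints W} (hP : addOrderOf P = ℓ)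
    (hst : ∀ σ : absoluteGaloisGroup ℚ, σ • P ∈ AddSubgroup.zmultiples P) :
    ¬ ((ℓ : ℤ) ∣ W.frobeniusTrace ℓ) := by
  sorry

/-- **LOCℓ (S assembly: semistable `v ∣ ℓ`, `ℓ` odd, `k ≥ 1`).**  The character of a stable cyclic line of
order `ℓᵏ` is, on the inertia groups at `ℓ`, EXACTLY `1` or EXACTLY `χ_{ℓᵏ}`.  Multiplicative ⇒ D3′;
good ⇒ SS (on `ℓ^{k−1}P`) excludes supersingular, D2; then D1 with `τ i := ` the action of `i ∈ I_𝔓`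
(`DistribMulAction.toAddMonoidHom`), `x i := χ(i).val`, `y i := 1`, `lam i := (r i).val`, witness
`i₀ ∈ I_𝔓` with `χ_{ℓᵏ}(i₀) ≢ 1 (mod ℓ)` from `exists_mem_inertia_modNCyclotomicCharacter_eq`
(`m = ℓᵏ = ℓ^{(k−1)+1}·1`, `a := ` a lift of `2`, `ℓ ≥ 3`); read `ℓᵏ ∣ (r τ).val − χ(τ).val` back in
`(ZMod ℓᵏ)ˣ`. -/
theorem cyclicCharacter_eq_one_or_eq_cyclotomic_at_ell (W : WeierstrassCurve ℚ) [W.IsElliptic]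
    [W.IsGloballyMinimal] (ℓ k : ℕ) [Fact ℓ.Prime] (hℓ2 : ℓ ≠ 2) (hk : 1 ≤ k)
    {v : HeightOneSpectrum (𝓞 ℚ)} (hℓv : (ℓ : 𝓞 ℚ) ∈ v.asIdeal) (hss : W.IsSemistableAt v)
    {P : geomPoints W} (hP : addOrderOf P = ℓ ^ k)
    {r : absoluteGaloisGroup ℚ →* (ZMod (ℓ ^ k))ˣ}
    (hr : ∀ σ : absoluteGaloisGroup ℚ, σ • P = ((r σ : (ZMod (ℓ ^ k))ˣ) : ZMod (ℓ ^ k)).val • P)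
    {𝔓 : Ideal (absIntegers (𝓞 ℚ) ℚ)} (h𝔓 : 𝔓 ∈ v.primesAbove) :
    (∀ τ ∈ 𝔓.inertia (absoluteGaloisGroup ℚ), r τ = 1) ∨
      (∀ τ ∈ 𝔓.inertia (absoluteGaloisGroup ℚ), r τ = modNCyclotomicCharacter ℚ (ℓ ^ k) τ) := by
  sorry

/-! ## §4 The other places, on ONE line -/

/-- U2 (S): at a multiplicative place `v ∤ ℓ` the character is trivial MODULO `ℓ^⌈k/2⌉` on inertia:
`smul_smul_sub_eq_of_mem_inertia_geomPoints` gives `((r τ).val − 1)²·P = 0`, then U1 and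
`ZMod.unitsMap`/`castHom` bookkeeping.  (Sharp: `11a3 → 11a1 → 11a2`, `(ℤ/9)²` at `v = 11`.) -/
theorem unitsMap_cyclicCharacter_eq_one_of_hasMultiplicativeReductionAt (W : WeierstrassCurve ℚ)
    [W.IsElliptic] {v : HeightOneSpectrum (𝓞 ℚ)} (hv : W.HasMultiplicativeReductionAt v)
    {ℓ k : ℕ} [Fact ℓ.Prime] (hℓv : (ℓ : 𝓞 ℚ) ∉ v.asIdeal) (hk : 1 ≤ k)
    {P : geomPoints W} (hP : addOrderOf P = ℓ ^ k)
    {r : absoluteGaloisGroup ℚ →* (ZMod (ℓ ^ k))ˣ}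
    (hr : ∀ σ : absoluteGaloisGroup ℚ, σ • P = ((r σ : (ZMod (ℓ ^ k))ˣ) : ZMod (ℓ ^ k)).val • P)
    {𝔓 : Ideal (absIntegers (𝓞 ℚ) ℚ)} (h𝔓 : 𝔓 ∈ v.primesAbove)
    {τ : absoluteGaloisGroup ℚ} (hτ : τ ∈ 𝔓.inertia (absoluteGaloisGroup ℚ)) :
    ZMod.unitsMap (pow_halfCeil_dvd ℓ k) (r τ) = 1 := by
  sorry

/-- T1 (PROVED, gen 3): `j` integral at a place `v ∤ 3m` ⇒ `r(τ)¹² = 1` on inertia at `v`. -/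
theorem cyclicCharacter_pow_twelve_eq_one_of_valuation_j_le_one (W : WeierstrassCurve ℚ)
    [W.IsElliptic] {m : ℕ} [NeZero m] {P : geomPoints W} (hP : addOrderOf P = m)
    {r : absoluteGaloisGroup ℚ →* (ZMod m)ˣ}
    (hr : ∀ σ : absoluteGaloisGroup ℚ, σ • P = ((r σ : (ZMod m)ˣ) : ZMod m).val • P)
    {v : HeightOneSpectrum (𝓞 ℚ)} (h3 : (3 : 𝓞 ℚ) ∉ v.asIdeal) (hmv : (m : 𝓞 ℚ) ∉ v.asIdeal)
    (hj : v.valuation ℚ W.j ≤ 1)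
    {𝔓 : Ideal (absIntegers (𝓞 ℚ) ℚ)} (h𝔓 : 𝔓 ∈ v.primesAbove)
    {τ : absoluteGaloisGroup ℚ} (hτ : τ ∈ 𝔓.inertia (absoluteGaloisGroup ℚ)) :
    r τ ^ 12 = 1 := by
  have hmP : m • P = 0 := by rw [← hP]; exact addOrderOf_nsmul_eq_zero P
  have h12 : τ ^ 12 • P = P :=
    Mazur1978.pow_twelve_smul_eq_of_mem_inertia_of_valuation_j_le_one_of_three W h3 hj h𝔓 hτ hmv hmP
  have h' : ((r (τ ^ 12) : (ZMod m)ˣ) : ZMod m).val • P = P := by rw [← hr]; exact h12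
  have h1 : ((r (τ ^ 12) : (ZMod m)ˣ) : ZMod m) = 1 :=
    Mazur1978.eq_one_of_val_smul_eq_of_addOrderOf W hP h'
  rw [map_pow] at h1
  exact Units.val_eq_one.mp h1

/-- T2 (S–M): `v(j) < 0` at a place `v ∤ ℓ` (here `v = 2`) ⇒ `r̄(τ)² = 1` on inertia at `v` (quadratic
twist multiplicative at `v`, `exists_hasMultiplicativeReductionAt_quadraticTwist_of_one_lt_valuation_j` +
the signed `exists_addEquiv_geomPoints_quadraticTwist_signed`, then U2 on the twist; prime-level pattern
`Mazur1978.isogenyCharacter_sq_eq_one_of_one_lt_valuation_j`). -/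
theorem unitsMap_cyclicCharacter_sq_eq_one_of_one_lt_valuation_j (W : WeierstrassCurve ℚ)
    [W.IsElliptic] {v : HeightOneSpectrum (𝓞 ℚ)} (hj : 1 < v.valuation ℚ W.j)
    {ℓ k : ℕ} [Fact ℓ.Prime] (hℓv : (ℓ : 𝓞 ℚ) ∉ v.asIdeal) (hk : 1 ≤ k)
    {P : geomPoints W} (hP : addOrderOf P = ℓ ^ k)
    {r : absoluteGaloisGroup ℚ →* (ZMod (ℓ ^ k))ˣ}
    (hr : ∀ σ : absoluteGaloisGroup ℚ, σ • P = ((r σ : (ZMod (ℓ ^ k))ˣ) : ZMod (ℓ ^ k)).val • P)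
    {𝔓 : Ideal (absIntegers (𝓞 ℚ) ℚ)} (h𝔓 : 𝔓 ∈ v.primesAbove)
    {τ : absoluteGaloisGroup ℚ} (hτ : τ ∈ 𝔓.inertia (absoluteGaloisGroup ℚ)) :
    ZMod.unitsMap (pow_halfCeil_dvd ℓ k) (r τ) ^ 2 = 1 := by
  sorry

/-- OPEN (PROVED, gen 5): the character of a stable cyclic line has open kernel. -/
theorem isOpen_ker_of_smul_eq_of_addOrderOf (W : WeierstrassCurve ℚ) [W.IsElliptic] {m : ℕ}
    [NeZero m] {P : geomPoints W} (hP : addOrderOf P = m)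
    {r : absoluteGaloisGroup ℚ →* (ZMod m)ˣ}
    (hr : ∀ σ : absoluteGaloisGroup ℚ, σ • P = ((r σ : (ZMod m)ˣ) : ZMod m).val • P) :
    IsOpen ((r.ker : Subgroup (absoluteGaloisGroup ℚ)) : Set (absoluteGaloisGroup ℚ)) := by
  refine Subgroup.isOpen_mono (H₁ := MulAction.stabilizer (absoluteGaloisGroup ℚ) P) ?_
    (isOpen_stabilizer_point_holds W P)
  intro σ hσ
  rw [MulAction.mem_stabilizer_iff] at hσ
  rw [MonoidHom.mem_ker]
  have hfix : ((r σ : (ZMod m)ˣ) : ZMod m).val • P = P := by rw [← hr σ]; exact hσ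
  exact Units.val_eq_one.mp (Mazur1978.eq_one_of_val_smul_eq_of_addOrderOf W hP hfix)

/-! ## §5 GLOB — Minkowski on ONE auxiliary character (replaces gen 3 G1/D5's normal form) -/

/-- **GLOB (S).**  `W` globally minimal, semistable away from `2`, `ℓ` odd, `k ≥ 1`, `ℤP` stable of order
`ℓᵏ` with character `r`, `r̄ := r mod ℓ^⌈k/2⌉`, `χ̄ := χ_{ℓ^⌈k/2⌉}`.  Then `r̄¹² = 1` OR `r̄¹² = χ̄¹²`
identically on `Γ_ℚ`.  By LOCℓ (any one `𝔓 ∣ ℓ`; conjugate primes agree since the target is abelian):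
branch `r|_{I_ℓ} = 1` ⇒ `ψ := r̄¹²`, branch `r|_{I_ℓ} = χ` ⇒ `ψ := (r̄·χ̄⁻¹)¹²`
(`Mazur1978.unitsMap_modNCyclotomicCharacter`); `ψ` is trivial on EVERY inertia group — good `v ∤ 2ℓ`:
`Mazur1978.cyclicCharacter_eq_one_of_mem_inertia` (+ `χ` unramified off `ℓ`,
`modNCyclotomicCharacter_eq_one_of_mem_inertia`); multiplicative `v ∤ 2ℓ`: U2; `v = 2`: T1 / T2;
`v = ℓ`: by construction — and `ker ψ` is open (OPEN), so `ψ = 1`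
(`Mazur1978.monoidHom_eq_one_of_forall_inertia`). -/
theorem unitsMap_cyclicCharacter_pow_twelve_dichotomy (W : WeierstrassCurve ℚ) [W.IsElliptic]
    [W.IsGloballyMinimal] (ℓ k : ℕ) [Fact ℓ.Prime] (hℓ2 : ℓ ≠ 2) (hk : 1 ≤ k)
    (hss : ∀ v : HeightOneSpectrum (𝓞 ℚ), (2 : 𝓞 ℚ) ∉ v.asIdeal → W.IsSemistableAt v)
    {P : geomPoints W} (hP : addOrderOf P = ℓ ^ k)
    {r : absoluteGaloisGroup ℚ →* (ZMod (ℓ ^ k))ˣ}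
    (hr : ∀ σ : absoluteGaloisGroup ℚ, σ • P = ((r σ : (ZMod (ℓ ^ k))ˣ) : ZMod (ℓ ^ k)).val • P) :
    (∀ σ : absoluteGaloisGroup ℚ, ZMod.unitsMap (pow_halfCeil_dvd ℓ k) (r σ) ^ 12 = 1) ∨
      (∀ σ : absoluteGaloisGroup ℚ, ZMod.unitsMap (pow_halfCeil_dvd ℓ k) (r σ) ^ 12 =
        modNCyclotomicCharacter ℚ (ℓ ^ halfCeil k) σ ^ 12) := by
  sorry

/-! ## §6 H5 — the half-level Frobenius divisibility, and the counting end -/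

/-- `n₁₂(p) = p¹² + 1 − s₁₂(a_p, p) = #Ẽ(𝔽_{p¹²})` (gen 3–6, verbatim). -/
noncomputable def frobNorm (W : WeierstrassCurve ℚ) [W.IsGloballyMinimal] (p : ℕ) : ℤ :=
  (p : ℤ) ^ 12 + 1 - Mazur1978.frobTracePow (W.frobeniusTrace p) p 12

/-- A1 (PROVED, gen 4/5): a root `t` of `X² − aX + p` in `ℤ/n` (`p` a unit) with `t¹² = 1` OR
`t¹² = p¹²` forces `n ∣ p¹² + 1 − s₁₂(a,p)`. -/
theorem natCast_dvd_frobNorm_of_pow_twelve {n p : ℕ} [NeZero n] (a : ℤ) (hp : IsUnit (p : ZMod n))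
    {t : ZMod n} (hroot : t ^ 2 - (a : ZMod n) * t + (p : ZMod n) = 0)
    (ht : t ^ 12 = 1 ∨ t ^ 12 = (p : ZMod n) ^ 12) :
    (n : ℤ) ∣ (p : ℤ) ^ 12 + 1 - Mazur1978.frobTracePow a p 12 := by
  have hprod' : t * ((a : ZMod n) - t) = (p : ZMod n) := by
    linear_combination (-1 : ZMod n) * hroot
  have hsum : t + ((a : ZMod n) - t) = ((a : ℤ) : ZMod n) := by ring
  have hprod : t * ((a : ZMod n) - t) = (((p : ℕ) : ℤ) : ZMod n) := by
    rw [hprod', Int.cast_natCast]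
  have hspec := Mazur1978.frobTracePow_spec hsum hprod 12
  have h12 : ((a : ZMod n) - t) ^ 12 * t ^ 12 = (p : ZMod n) ^ 12 := by
    rw [← mul_pow, mul_comm, hprod']
  rw [← ZMod.intCast_zmod_eq_zero_iff_dvd]
  push_cast
  rw [← hspec]
  rcases ht with h1 | h2
  · rw [h1, mul_one] at h12
    rw [h1, h12]; ring
  · rw [h2] at h12
    have h3 : ((a : ZMod n) - t) ^ 12 = 1 :=
      (hp.pow 12).mul_right_cancel (h12.trans (one_mul _).symm)
    rw [h2, h3]; ring

/-- **H5 (S assembly).**  G0 gives `r` (`exists_cyclicCharacter_of_addOrderOf`); GLOB gives the branch; at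
an arithmetic Frobenius `φ` over the good `p ∤ 2ℓ` (`exists_isArithFrobAt…`),
`Mazur1978.cyclicCharacter_sq_sub_frobeniusTrace_mul_add_eq_zero` cast down
`ZMod (ℓᵏ) → ZMod (ℓ^⌈k/2⌉)` makes `t := r̄(φ)` a root of `X² − a_pX + p`,
`χ̄(φ) = p` (`modNCyclotomicCharacter_eq_residueCard_of_isArithFrobAt`), so `t¹² = 1` or `t¹² = p¹²`,
and A1 (`n = ℓ^⌈k/2⌉`, `p` a unit as `p ≠ ℓ`) concludes. -/
theorem pow_halfCeil_dvd_frobNorm_of_stableLine (W₁ : WeierstrassCurve ℚ) [W₁.IsElliptic]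
    [W₁.IsGloballyMinimal] (ℓ k : ℕ) [Fact ℓ.Prime] (hℓ2 : ℓ ≠ 2)
    (hss : ∀ v : HeightOneSpectrum (𝓞 ℚ), (2 : 𝓞 ℚ) ∉ v.asIdeal → W₁.IsSemistableAt v)
    {P : geomPoints W₁} (hP : addOrderOf P = ℓ ^ k)
    (hst : ∀ σ : absoluteGaloisGroup ℚ, σ • P ∈ AddSubgroup.zmultiples P)
    (p : ℕ) [Fact p.Prime] (hp2 : p ≠ 2) (hpℓ : p ≠ ℓ) (hgood : W₁.HasGoodReductionAtPrime p) :
    (ℓ : ℤ) ^ halfCeil k ∣ frobNorm W₁ p := by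
  sorry

/-- G0 (XS glue): the `ℓ`-primary part of the (cyclic, stable) kernel of a cyclic isogeny is a stable
cyclic line of order `ℓ^{v_ℓ(deg)}`. -/
theorem exists_stableLine_of_isCyclic {W₁ W₂ : WeierstrassCurve ℚ} [W₁.IsElliptic] [W₂.IsElliptic]
    (φ : Isogeny W₁ W₂) (hφ : φ.IsCyclic) (ℓ k : ℕ) [Fact ℓ.Prime] (hdiv : ℓ ^ k ∣ φ.degree) :
    ∃ P : geomPoints W₁, addOrderOf P = ℓ ^ k ∧
      ∀ σ : absoluteGaloisGroup ℚ, σ • P ∈ AddSubgroup.zmultiples P := by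
  sorry

/-- C1 (PROVED, gen 3): half exponents at every prime give `d ∣ n²`. -/
theorem dvd_sq_of_forall_pow_halfCeil_dvd {d n : ℕ} (hd : 0 < d) (hn : 0 < n)
    (h : ∀ ℓ : ℕ, ℓ.Prime → ℓ ∣ d → ℓ ^ halfCeil (d.factorization ℓ) ∣ n) : d ∣ n ^ 2 := by
  rw [← Nat.factorization_le_iff_dvd hd.ne' (pow_pos hn 2).ne', Nat.factorization_pow]
  refine Finsupp.le_def.mpr fun ℓ => ?_
  rw [Finsupp.smul_apply, smul_eq_mul]
  by_cases hℓ : ℓ.Prime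
  · by_cases hℓd : ℓ ∣ d
    · have h2 : halfCeil (d.factorization ℓ) ≤ n.factorization ℓ :=
        (hℓ.pow_dvd_iff_le_factorization hn.ne').mp (h ℓ hℓ hℓd)
      have h3 := le_two_mul_halfCeil (d.factorization ℓ)
      omega
    · rw [Nat.factorization_eq_zero_of_not_dvd hℓd]; exact Nat.zero_le _
  · rw [Nat.factorization_eq_zero_of_not_prime d hℓ]; exact Nat.zero_le _

/-- **C0² (the typed, Mazur–Kenku-free output of the line; gen 3 verbatim).**  For `W₁` globally minimal
and semistable away from `2`, a cyclic isogeny out of `W₁` has degree dividing `16·(n₁₂(p₀)·n₁₂(p₁))²`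
for any two distinct odd good primes (G0 + H5 at the `pᵢ ≠ ℓ` + C1 for the odd part; the landed
`Summit.ABC.ABC.Theorems.isogeny_isCyclic_degree_ne_thirtyTwo` + `Isogeny.exists_isCyclic_degree_eq_of_dvd`
for the `2`-part). -/
def CyclicDegreeDvdFrobNormSq : Prop :=
  ∀ (W₁ W₂ : WeierstrassCurve ℚ) [W₁.IsElliptic] [W₂.IsElliptic] [W₁.IsGloballyMinimal],
    (∀ v : HeightOneSpectrum (𝓞 ℚ), (2 : 𝓞 ℚ) ∉ v.asIdeal → W₁.IsSemistableAt v) →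
    ∀ (φ : Isogeny W₁ W₂), φ.IsCyclic →
    ∀ (p₀ p₁ : ℕ) [Fact p₀.Prime] [Fact p₁.Prime], p₀ ≠ 2 → p₁ ≠ 2 → p₀ ≠ p₁ →
      W₁.HasGoodReductionAtPrime p₀ → W₁.HasGoodReductionAtPrime p₁ →
      φ.degree ∣ 16 * ((frobNorm W₁ p₀ * frobNorm W₁ p₁).natAbs) ^ 2

theorem cyclicDegreeDvdFrobNormSq : CyclicDegreeDvdFrobNormSq := by
  sorry

/-- G4 leaf, verbatim (`StubIdeasK2G4PastenLemma68.lean`; its consumer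
`definiteRTControlPrime_of_freyClassRadiusSubpoly (hT) (hRad) : DefiniteRTControlPrime` is PROVED there). -/
def FreyClassRadiusSubpoly : Prop :=
  ∀ ε : ℝ, 0 < ε → ∃ R : ℝ, ∀ (a b : ℤ), IsCoprime a b → a * b * (a + b) ≠ 0 →
    ∀ q : ℕ, q.Prime → q ≠ 2 → q ∣ (freyCurve a b).conductorNorm ℤ →
    ∀ (W₁ W₂ : WeierstrassCurve ℚ) [W₁.IsElliptic] [W₂.IsElliptic],
      W₁.IsIsogenous (freyCurve a b) → W₂.IsIsogenous (freyCurve a b) →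
        ∃ φ : Isogeny W₁ W₂,
          (φ.degree : ℝ) ≤ R * (((freyCurve a b).conductorNorm ℤ : ℕ) : ℝ) ^ ε

/-- B0² (gen 6 B0 with exponent `2·… ` in place of `3`): class radius from two odd good primes. -/
def FreyClassRadiusTwoPrimes : Prop :=
  ∀ (a b : ℤ), IsCoprime a b → a * b * (a + b) ≠ 0 →
    ∀ (W₁ W₂ : WeierstrassCurve ℚ) [W₁.IsElliptic] [W₂.IsElliptic],
      W₁.IsIsogenous (freyCurve a b) → W₂.IsIsogenous (freyCurve a b) →
      ∀ p₀ p₁ : ℕ, p₀.Prime → p₁.Prime → p₀ ≠ 2 → p₁ ≠ 2 → p₀ ≠ p₁ →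
        ¬ (p₀ : ℤ) ∣ a * b * (a + b) → ¬ (p₁ : ℤ) ∣ a * b * (a + b) →
        ∃ φ : Isogeny W₁ W₂, φ.degree ≤ 16 * ((p₀ ^ 6 + 1) * (p₁ ^ 6 + 1)) ^ 4

/-- **B1 (S, gen 6 with exponent 2).**  C0² ⟹ B0²: Néron model `C • W₁` (`hasGlobalMinimalModel_rat_holds`,
`VariableChange.toIsogeny`), a CYCLIC isogeny `C • W₁ → W₂` (`IsIsogenous.exists_isCyclic`), semistability
away from `2` and good reduction at `pᵢ` transported from the Frey curve (gen 6 SEMI/GR), C0², Hasse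
`0 < n₁₂(p) ≤ (p⁶+1)²` (gen 6 H7/H7′), `Nat.le_of_dvd`, `degree_comp`. -/
theorem freyClassRadiusTwoPrimes_of_sq (h0 : CyclicDegreeDvdFrobNormSq) : FreyClassRadiusTwoPrimes := by
  sorry

/-- **B2 (S, gen 6 verbatim up to the exponent).**  B0² ⟹ the `N^ε` class radius (in fact `≪ (log N)⁴⁸`):
two odd primes `p₀ ≠ p₁ ∤ N` of size `≤ C log N + C` (`exists_prime_not_dvd_le_log`, twice), `pᵢ ∤ ab(a+b)`
(`radical_natAbs_dvd_two_mul_conductorNorm_freyCurve`), `Real.log_le_rpow_div`. -/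
theorem freyClassRadiusSubpoly_of_twoPrimes (h : FreyClassRadiusTwoPrimes) : FreyClassRadiusSubpoly := by
  sorry

/-- The counting end, composed: C0² ⟹ `FreyClassRadiusSubpoly`; then (G4, proved)
`definiteRTControlPrime_of_freyClassRadiusSubpoly stub_takahashi (freyClassRadiusSubpoly_of_sq C0²)`. -/
theorem freyClassRadiusSubpoly_of_sq (h0 : CyclicDegreeDvdFrobNormSq) : FreyClassRadiusSubpoly :=
  freyClassRadiusSubpoly_of_twoPrimes (freyClassRadiusTwoPrimes_of_sq h0)

/-! ## Sanity (in-kernel quick refuters)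
(1) D1's degenerate exponents: `halfCeil 1 = 1` (prime level = Mazur's exact dichotomy), `halfCeil 2 = 1`
    (the `(ℤ/9)²`-sharp case `11a3 → 11a2`), `halfCeil 4 = 2`.
(2) `11a1`, `p = 3` (`a₃ = −1`): `n₁₂(3) = 3¹² + 1 + 1358 = 532800 = 2⁶·3²·5²·37`, and `5 ∣ 532800`
    (the `25`-isogeny `11a3 → 11a2` needs `5^⌈2/2⌉ = 5 ∣ n₁₂(3)`: consistent; `25 ∣ n₁₂(3)` too). -/
example : halfCeil 1 = 1 ∧ halfCeil 2 = 1 ∧ halfCeil 3 = 2 ∧ halfCeil 4 = 2 := by decide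
example : Mazur1978.frobTracePow (-1) 3 12 = -1358 := by decide
example : (3 : ℤ) ^ 12 + 1 - (-1358) = 532800 ∧ (25 : ℤ) ∣ 532800 := by decide

end Summit.ABC.ABC.Cruxes.DefiniteRTControlPrime.Sketch.Ideas2g7
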